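import Summits.Langlands.Langlands.Theorems.SqrtFiveQuarticCoversCertificates

/-!
# Route `SqrtFiveQuarticCovers` — the split of the crux `RefinedLocusModular` into five certificate
children, glued modulo the two printed bridge facts (lg-quartmod asm-plan; `--supports` the glue item)

The crux `RefinedLocusModular` (stmt-Langlands-17833) was SPLIT on the ledger (planner verb
`route edit --split`, director-frontier ORDER 2026-08-28T20:30:18Z, lead SHEET-WORDS v0.1) into the
five certificate children — statements = the hypothesis types `hA hB7 hC hE hD` of
`refinedLocusModular_of_certificates` (`Theorems/SqrtFiveQuarticCoversCertificates.lean`, p653708)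
VERBATIM —

* `CertB3H8`  (= `hA`;  carrier `X(b3,H8) = X₀(75)^ε`, genus 5; sheets 4.2 + 4.6; the mod-7
  disjunction `b7 ∨ e7` is load-bearing: `b3 ∧ H8` alone is false at pair level, orbit B),
* `CertH12B7` (= `hB7`; carrier `Z = X(H12,b7)`, genus 9; sheets 4.1 + 4.3; mod-3 free),
* `CertS3H8`  (= `hC`;  carrier `X(s3,H8) = (X₀(225)/w₉)^ε`, genus 9; sheets 4.4 + 4.8; mod-7 free),
* `CertB3E7`  (= `hE`;  carrier `X(b3,e7)/ℚ`, genus 9; sheet 4.5; mod-5 free),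
* `CertS3H12` (= `hD`;  carrier `X(s3,H12)`, genus 7, over `X(s3,ns⁺5)`, genus 3; sheet 4.7; mod-7 free),

each concluding the FINITE DATUM «geometric CM ∨ j(E) ∈ ℚ(√5)» (division-free), and the generated
glue item `RefinedLocusModularGlue : CertB3H8 → CertH12B7 → CertS3H8 → CertB3E7 → CertS3H12 →
RefinedLocusModular`.

This file proves the glue item MODULO EXACTLY the two named printed facts behind the bridge
«`j(E) ∈ ℚ(√5)`, `K ∋ √5` totally real quartic ⇒ `E` modular» — `FLS2015_theorem1` (Freitas–Le
Hung–Siksek 2015, Thm. 1: elliptic curves over real quadratic fields are modular) and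
`isModularEllipticCurve_baseChange_of_isSolvable_of_isAutomorphicOfWeightZero` (solvable base change,
Thorne 2016, Lemma 7.1) — by re-keying `refinedLocusModular_of_certificates` over the child decls
(`refinedLocusModularGlue_of_facts`), and restates the route's `Target` over the children and the
nine named printed facts (`target_of_sheets_of_facts`).  Both theorems are CONDITIONAL
(`proof.conditional`): they close nothing on the ledger; the glue item stays OPEN as a conditional
result by design (it carries the modularity content).

RECORD LABEL (director-frontier 20:30:18Z): «`RefinedLocusModular` closed in tree MODULO the printed
theorems named in the hypotheses + five named certified finite computations, each on two independent
exact lineages» — a FRONTIER RECORD of referee grade; a certified finite datum is not a modularity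
statement, and nothing in this file proves modularity of any curve.
[cite: FreitasLeHungSiksek2015, Thm. 1 and §§5–7] [cite: Box2022, Thms. 1.1, 1.5, §7] [cite: Thorne2016, Lemma 7.1]
-/

set_option linter.dupNamespace false -- project-wide option (lakefile weak.linter.dupNamespace); `Summit.Langlands.Langlands` is the mandated namespace

namespace Summit.Langlands.Langlands.Theorems.SqrtFiveQuarticCovers

open Literature.NumberTheory.Automorphic Summit.Langlands.Langlands.Theses.SqrtFiveQuarticCovers

/-- **GLUE of the `RefinedLocusModular` split, modulo the two printed bridge facts.**  The five
certificate children (finite data: geometric CM or `j ∈ ℚ(√5)` on each carrier) imply the crux, GIVEN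
`FLS2015_theorem1` and solvable base change (Thorne 2016 L7.1): this is
`refinedLocusModular_of_certificates` (p653708) re-keyed over the child decls — the children are its
hypotheses `hA hB7 hC hE hD` verbatim, so the term typechecks by definitional unfolding only.
CONDITIONAL; kernel-checked logic only; the glue item stays open as a conditional result.
[cite: FreitasLeHungSiksek2015, Thm. 1] [cite: Thorne2016, Lemma 7.1] -/
theorem refinedLocusModularGlue_of_facts
    (hFLS : FLS2015_theorem1)
    (hBC : isModularEllipticCurve_baseChange_of_isSolvable_of_isAutomorphicOfWeightZero) :
    RefinedLocusModularGlue :=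
  fun hA hB7 hC hE hD => refinedLocusModular_of_certificates hA hB7 hC hD hE hFLS hBC

/-- **The route's `Target` over the five certificate children and the nine named printed facts**:
every elliptic curve over every totally real quartic field is modular (trace-only sense), GIVEN the
children `CertB3H8 … CertS3H12`, the bridge facts `FLS2015_theorem1` + solvable base change, and
`Box2022_theorem1_1`, `Box2022_theorem1_5_modular`, `FLS2015_theorem3`, `FLS2015_theorem4`,
`Kalyanswamy2018_theorem1_2` — `target_of_certificates_of_facts` (p653708) re-keyed.  CONDITIONAL;
nothing here proves modularity of any curve. [cite: Box2022, Thms. 1.1, 1.5 and 7.1] -/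
theorem target_of_sheets_of_facts
    (hA : CertB3H8) (hB7 : CertH12B7) (hC : CertS3H8) (hE : CertB3E7) (hD : CertS3H12)
    (hFLS : FLS2015_theorem1)
    (hBC : isModularEllipticCurve_baseChange_of_isSolvable_of_isAutomorphicOfWeightZero)
    (h11 : Box2022_theorem1_1) (h15 : Box2022_theorem1_5_modular) (h3 : FLS2015_theorem3)
    (h4 : FLS2015_theorem4) (hKal : Kalyanswamy2018_theorem1_2) : Target :=
  target_of_certificates_of_facts hA hB7 hC hD hE hFLS hBC h11 h15 h3 h4 hKal

end Summit.Langlands.Langlands.Theorems.SqrtFiveQuarticCovers
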